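import Summits.QuantumFields.BalabanUV.T4Continuum.Support.B13StepEndArithmetic
import Summits.QuantumFields.BalabanUV.T4Continuum.Support.B13StepSecantArithmetic
import Summits.QuantumFields.BalabanUV.T4Continuum.Support.OutputRateWindowBounded

/-!
# NE5 ∕ U3 — THE η-UNIFORM END FACES OF RECORD REASSEMBLE FROM SINGLETON WINDOWS WITH THE SAME CONSTANT
# (owner RULING R24 «instantiate per singleton window `{g}` with g-indexed dictionaries, then reassemble», `OutputRateWindow`
# p216401; RULING R29 ∕ referee INFO-27 «reassembly needs ONE g-uniform `C₅`», `OutputRateWindowBounded` p216987 — read for the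
# letters-eliminated η-UNIFORM faces of this lineage: `B13StepEndArithmetic.uniform_ne5_of_record[_insOp]` (N69) and
# `B13StepSecantArithmetic.uniform_ne5_of_record_secant` (N80); owner RULING R29′ + GO, journal l.12309: «`∃`-OUTERMOST uniform faces
# reassemble freely; `∃`-after-`W` faces iff the per-window constants are bounded on W»)

Cell `pub-balaban`, unit `b2b-balaban-t4-ne5-formalise-leaf-10` (NE5 formalisation swarm, LEAF PROVER 10, gen 5; row O6-n NUMERICS +
the arithmetic followers of the END faces of record; journal INTENT `CLAIMS.log` l.12288, CLAIM RULE 1; owner GO + RULING R29′ l.12309).  Summits-side new work under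
the LEAN PLACEMENT RULE (cell bookkeeping; NOT a Literature module; 0 `def`, 0 cite tag); nothing landed is edited — three landed faces
and the owner's window lemmas (`OutputRateWindow` p216401, `OutputRateWindowBounded` p216987) are applied BY NAME.  HONEST FRAMING: rung (B)+1 of the FINITE-VOLUME T⁴ continuum programme — NOT
infinite volume, NOT a mass gap, NOT the Clay problem, and **NOT A PROOF OF NE5** (NOT PRINTED in [Balaban1987RG1]–
[Balaban1989LargeFieldII], which print ε-UNIFORM bounds, never η-RATES; cell GAPS G-t4-U3-1): every theorem below is an IMPLICATION
whose wall binders (W1 in row NE2's entry currency, W2 termwise ∕ per-activity data, W3 slice budgets, W4, the quoted one-run levels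
L05∕L06 — [Balaban1987RG1] (1.18) p. 263, SHAPE only —, the radii) are DISPLAYED HYPOTHESES, asserted nowhere.  HONEST DEPENDENCY (cell
line, verbatim): continuum YM on T⁴ ⇐ BetaPertH ∧ nine spine estimates (0/9 proved); BetaPertH ⇐ (D1) ∧ (D4) ∧ CAP+tail; G-an2-4
gates asym, D1 and NE2/3/4.

THE POINT (quantifier order, decls not adjectives).  `T4OutputRate.NE5 EA EB W κ θ C₅` is `∀ g ∈ W, …` outermost, so
`NE5 … W … C₅ ↔ ∀ g ∈ W, NE5 … {g} … C₅` (`OutputRateWindow.ne5_iff_forall_singleton`) — with ONE `C₅`.  A face of the form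
`∃ C₅, NE5 … W … C₅` applied per singleton gives `∀ g, ∃ C₅(g)` only (owner's negative control `OutputRateWindowBounded.grow_not_exists_uniform`:
genuinely weaker); such faces are TERMINAL for their window (R29) — e.g. this lineage's `exists_ne5_of_record*`.  The η-UNIFORM faces of
this lineage are NOT of that form: they read `∃ C₅, ∀ {𝔾} [GaugeGroup 𝔾] {R} {E IOp Hist} … (S) {W} …, S.D.ω = ω → ⟨binders at W⟩ →
NE5 (outA S E₀ cB) (outB S E₀ cB) W κ θ′ C₅` — the constant is produced from the g-free SIZE letters BEFORE the pair of runs, the slot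
package and the window are bound.  Hence R24's recipe runs through them at NO cost in the constant: supply EVERY displayed binder PER
SINGLETON WINDOW `{g}`, with g-INDEXED dictionaries where the binder has one (the termwise weights `a g`, the per-activity data `N g`,
`A g`, `Dt g`) and the COMMON size letters, and conclude NE5 ON `W` with the SAME `C₅` — for every pair of runs, slot package, window
and coupling in it.

WHAT THIS FILE DOES.
* §1 `ne5_of_windowwise` — the abstract form: a face uniform in the window (`∀ W′, B W′ → NE5 EA EB W′ κ θ C₅`, `B` any predicate on
  windows) and `∀ g ∈ W, B {g}` give `NE5 EA EB W κ θ C₅` (`ne5_of_forall_singleton`); `ne5_of_windowwise_param` (outputs and binders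
  indexed by a parameter bound after the constant); and R29′ (b)'s mechanism BY NAME: `ne5_of_windowwise_le` (a face with a
  WINDOW-DEPENDENT constant `Cf W′` reassembles under a DISPLAYED common bound `Cf {g} ≤ C₅` on `W` — the owner's
  `OutputRateWindowBounded.ne5_of_forall_singleton_le`), `ne5_of_windowwise_exists_le` (an `∃`-after-`W′` face reassembles iff its
  per-singleton constants admit a displayed common bound — `ne5_of_forall_singleton_exists_le`; without the bound it is TERMINAL,
  negative control `grow_not_exists_uniform` there).
* §2 **`uniform_ne5_of_record_singleton`** — N69's `uniform_ne5_of_record` (E1[rec], W1 in row NE2's entry currency, W4 displayed)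
  with every displayed binder PER SINGLETON and a g-indexed termwise dictionary `a g` of common budget `G`; same sizes, same two strict
  size inequalities; ONE `C₅`.
* §3 **`uniform_ne5_of_record_insOp_singleton`** — N69's `uniform_ne5_of_record_insOp` (E1[rec] with W4 PRODUCED from the
  insertion-operator species) likewise; the insertion margin `rI` may depend on `g` too.
* §4 **`uniform_ne5_of_record_secant_singleton`** — N80's `uniform_ne5_of_record_secant` (E8 at the assembly of record, history half of
  W2 at activity level with g-indexed data `N g`, `A g`, `Dt g`, operator half displayed `OpLipschitz … {g} κ Λop ρ₀`) likewise.
NOT claimed: any estimate; any value of a letter; that Bałaban's step satisfies a binder.  The g-uniformity of the SIZES over the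
printed coupling window ]0, γ] is exactly what [Balaban1988RG2Cluster] asserts of its O(1) constants («uniform in k and in the
couplings», p. 21 KIND) — DISPLAYED here as the hypothesis that one tuple of letters serves every `g ∈ W`, not asserted.  0 sorry;
axioms ⊆ {propext, Classical.choice, Quot.sound}.
-/

noncomputable section

open Metric Set

namespace Summit.QuantumFields.BalabanUV.T4Continuum.B13StepEndArithmeticWindow

open Literature.MathematicalPhysics.QuantumFieldTheory.Balaban1983to89
open Literature.MathematicalPhysics.QuantumFieldTheory.Balaban1983to89.T4OutputRate (Carriers Functional DecayBound NE5)
open Literature.MathematicalPhysics.QuantumFieldTheory.Balaban1983to89.T4InputCauchyRateData (StepModel)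
open Literature.MathematicalPhysics.QuantumFieldTheory.Balaban1983to89.T4InputCauchyRateSpecies (ballClass OpLipschitz)
open Literature.MathematicalPhysics.QuantumFieldTheory.Balaban1983to89.T4InputCauchyRateTermwise
  (TermBound TermBudget TermLineAnalytic)
open Summit.QuantumFields.BalabanUV.T4Continuum.B13Carriers (TwoRuns)
open Summit.QuantumFields.BalabanUV.T4Continuum.B13OpDatum (OpDatum)
open Summit.QuantumFields.BalabanUV.T4Continuum.B13OpDatumJunctions (RawBounded WeightedEntrywiseRate)
open Summit.QuantumFields.BalabanUV.T4Continuum.B13StepTermLabels (TermIdx InnerLabel)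
open Summit.QuantumFields.BalabanUV.T4Continuum.B13StepTermFamily (term ActData ActExpLinearOn)
open Summit.QuantumFields.BalabanUV.T4Continuum.B13InnerData (Bnd)
open Summit.QuantumFields.BalabanUV.T4Continuum.B13TermRep (actMajorant)
open Summit.QuantumFields.BalabanUV.T4Continuum.B13TermHistSecant (ActExpNormBound ActAbsBound secMajorant)
open Summit.QuantumFields.BalabanUV.T4Continuum.B13Base (selfCtr)
open Summit.QuantumFields.BalabanUV.T4Continuum.B13StepOfRecord (Slots assembly step outA outB)
open Summit.QuantumFields.BalabanUV.T4Continuum.B13StepEndArithmetic (uniform_ne5_of_record uniform_ne5_of_record_insOp)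
open Summit.QuantumFields.BalabanUV.T4Continuum.B13StepSecantArithmetic (uniform_ne5_of_record_secant)
open Summit.QuantumFields.BalabanUV.T4Continuum.OutputRateWindow (ne5_of_forall_singleton)
open Summit.QuantumFields.BalabanUV.T4Continuum.OutputRateWindowBounded
  (ne5_of_forall_singleton_le ne5_of_forall_singleton_exists_le)

/-! ## §1 A face uniform in the window reassembles from singleton windows -/

section Abstract

variable {C : Carriers} {EA : Functional C C.BgA} {EB : Functional C C.BgB} {W : Set (ℕ → ℝ)} {κ θ C₅ : ℝ}

/-- [folklore] **A FACE UNIFORM IN THE WINDOW REASSEMBLES FROM SINGLETONS WITH ITS OWN CONSTANT.**  If a face delivers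
`NE5 EA EB W′ κ θ C₅` from binders `B W′` for EVERY window `W′` with one and the same `C₅` (the constant was fixed before the window),
then the binders at every singleton `{g}`, `g ∈ W`, give `NE5 EA EB W κ θ C₅` (owner's `OutputRateWindow.ne5_of_forall_singleton`).
Contrast (R29): a face `B W′ → ∃ C₅, NE5 EA EB W′ κ θ C₅` applied per singleton gives only `∀ g ∈ W, ∃ C₅, …` — NOT `NE5` on `W`
(`OutputRateWindowBounded.grow_not_exists_uniform`). -/
theorem ne5_of_windowwise {B : Set (ℕ → ℝ) → Prop} (h : ∀ W', B W' → NE5 EA EB W' κ θ C₅) (hB : ∀ g ∈ W, B {g}) :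
    NE5 EA EB W κ θ C₅ :=
  ne5_of_forall_singleton fun g hg => h {g} (hB g hg)

/-- [folklore] The same for a face whose binders and OUTPUTS are indexed by a parameter `s` (a slot package, a pair of runs, …) bound
AFTER the constant: uniformity in `s` and in the window at once. -/
theorem ne5_of_windowwise_param {σ : Sort*} {EAs : σ → Functional C C.BgA} {EBs : σ → Functional C C.BgB}
    {B : σ → Set (ℕ → ℝ) → Prop} (h : ∀ s W', B s W' → NE5 (EAs s) (EBs s) W' κ θ C₅) (s : σ) (hB : ∀ g ∈ W, B s {g}) :
    NE5 (EAs s) (EBs s) W κ θ C₅ :=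
  ne5_of_forall_singleton fun g hg => h s {g} (hB g hg)

/-- [folklore] **R29′ (b), THE COMMON-BOUND MECHANISM** (owner's `OutputRateWindowBounded.ne5_of_forall_singleton_le` BY NAME): a face
whose constant DEPENDS ON THE WINDOW, `∀ W′, B W′ → NE5 EA EB W′ κ θ (Cf W′)`, reassembles from the singletons of `W` under a DISPLAYED
common bound `Cf {g} ≤ C₅` (`g ∈ W`) and `0 ≤ θ`. -/
theorem ne5_of_windowwise_le {B : Set (ℕ → ℝ) → Prop} {Cf : Set (ℕ → ℝ) → ℝ} (h : ∀ W', B W' → NE5 EA EB W' κ θ (Cf W'))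
    (hB : ∀ g ∈ W, B {g}) (hle : ∀ g ∈ W, Cf {g} ≤ C₅) (hθ : 0 ≤ θ) : NE5 EA EB W κ θ C₅ :=
  ne5_of_forall_singleton_le (Cg := fun g => Cf {g}) (fun g hg => h {g} (hB g hg)) hle hθ

/-- [folklore] **R29′ (b) FOR `∃`-AFTER-THE-WINDOW FACES** (this lineage's `exists_ne5_of_record*`, per-window census faces): such a
face `∀ W′, B W′ → ∃ C, NE5 EA EB W′ κ θ C` reassembles from singletons ONLY together with a displayed common bound on the per-singleton
constants — here in the owner's form `∃ C, C ≤ C₅ ∧ NE5 … {g} … C` (`ne5_of_forall_singleton_exists_le`); WITHOUT the bound it is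
TERMINAL for its window (negative control `OutputRateWindowBounded.grow_not_exists_uniform`). -/
theorem ne5_of_windowwise_exists_le {B : Set (ℕ → ℝ) → Prop}
    (h : ∀ W', B W' → ∃ C, C ≤ C₅ ∧ NE5 EA EB W' κ θ C) (hB : ∀ g ∈ W, B {g}) (hθ : 0 ≤ θ) : NE5 EA EB W κ θ C₅ :=
  ne5_of_forall_singleton_exists_le (fun g hg => h {g} (hB g hg)) hθ

end Abstract

/-! ## §2 E1[rec] (termwise END of record, letters eliminated, η-uniform) per singleton window -/

section Termwise

/-- [folklore] **THE η-UNIFORM TERMWISE FACE OF RECORD IS g-UNIFORM ACROSS SINGLETON WINDOWS.**  Fix the displayed SIZES as in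
`B13StepEndArithmetic.uniform_ne5_of_record` — decay rate `κ`, COMMON termwise budget `G`, one-run levels `EA₀, E₀`, slice constants
`cA, cB`, row NE2's entry constant `c₁` and margin floor `r₀`, W4's `δ′`, input rate `0 < θ < 1`, target rate `θ ≤ θ′ ≤ 1`, age
damping `0 < ω < 1` — subject to the two strict size inequalities `cA(EA₀ + E₀) < 1 − ω`, `ω + G·cA·(1 − ω)∕(1 − ω − cA(EA₀ + E₀)) < θ′`.
Then ONE constant `C₅` serves every pair of runs `R`, every slot package `S` with `S.D.ω = ω`, every window `W` and EVERY COUPLING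
`g ∈ W` SEPARATELY: if each displayed binder of the face holds AT THE SINGLETON WINDOW `{g}` for every `g ∈ W` — the transport reading,
the two one-run slice budgets, the levels `DecayBound (outA S E₀ cB) {g} EA₀ κ` ∕ `DecayBound (outB S E₀ cB) {g} E₀ κ`, bounded raw
suppliers + row NE2's weighted entrywise rate `c₁·θ^k` + floor, W4 `InsertionRate {g} κ E₀ δ′ θ`, and the termwise W2 data on the
roomy class with a g-INDEXED dictionary `a g` (`TermBound … {g} κ (a g)`, `TermBudget (a g) G`, `TermLineAnalytic … {g}`) —, then
`NE5 (outA S E₀ cB) (outB S E₀ cB) W κ θ′ C₅`.  (R24's «g-indexed dictionaries on singleton windows, then reassemble», at no cost in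
the constant; proof = `uniform_ne5_of_record` ∘ `ne5_of_forall_singleton`.)  NOT a proof of NE5: an implication from displayed binders. -/
theorem uniform_ne5_of_record_singleton {κ G EA₀ E₀ cA cB c₁ r₀ δ' θ θ' ω : ℝ}
    (hE₀ : 0 ≤ E₀) (hG : 0 ≤ G) (hcA : 0 ≤ cA) (hcB : 0 ≤ cB) (hc₁ : 0 ≤ c₁) (hr₀ : 0 < r₀) (hδ' : 0 ≤ δ')
    (hθ0 : 0 < θ) (hθ1 : θ < 1) (hθθ' : θ ≤ θ') (hθ'1 : θ' ≤ 1) (hω : 0 < ω) (hω1 : ω < 1)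
    (hh : cA * (EA₀ + E₀) < 1 - ω) (hsmall : ω + G * cA * (1 - ω) / (1 - ω - cA * (EA₀ + E₀)) < θ') :
    ∃ C₅ : ℝ, ∀ {𝔾 : Type} [GaugeGroup 𝔾] {R : TwoRuns 𝔾} {E IOp Hist : Type*} [NormedAddCommGroup Hist] [NormedSpace ℂ Hist]
      (S : Slots R E IOp Hist) {W : Set (ℕ → ℝ)} {ROp RHist : ℕ → ℝ} {a : (ℕ → ℝ) → ℕ → TermIdx R.carriers.Dom (Bnd R) → ℝ},
      S.D.ω = ω →
      (∀ g ∈ W, (assembly S).TransportReads {g}) →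
      (∀ g ∈ W, (assembly S).SliceBudgetB {g} κ cB) → (∀ g ∈ W, S.D.SliceBudget (step S E₀ cB) {g} κ cA) →
      (∀ g ∈ W, DecayBound (outA S E₀ cB) {g} EA₀ κ) → (∀ g ∈ W, DecayBound (outB S E₀ cB) {g} E₀ κ) →
      (∀ g ∈ W, RawBounded S.F (assembly S).rawAt {g}) → (∀ g ∈ W, RawBounded S.F S.rawB {g}) →
      (∀ g ∈ W, WeightedEntrywiseRate S.F (assembly S).rawAt S.rawB {g} c₁ (fun k => θ ^ k)) → (∀ k, r₀ ≤ S.rOp k) →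
      (∀ g ∈ W, (step S E₀ cB).InsertionRate {g} κ E₀ δ' θ) →
      (∀ g ∈ W, TermBound (ballClass (selfCtr (assembly S).raw (assembly S).histRef) ROp RHist)
        (term (assembly S).𝒯 (assembly S).inc S.act) {g} κ (a g)) →
      (∀ g ∈ W, TermBudget (a g) G) →
      (∀ g ∈ W, TermLineAnalytic (ballClass (selfCtr (assembly S).raw (assembly S).histRef) ROp RHist)
        (term (assembly S).𝒯 (assembly S).inc S.act) {g}) →
      (∀ k, S.rOp k ≤ ROp k) → (∀ k, (assembly S).bHist E₀ cB k + S.rHist k ≤ RHist k) →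
      NE5 (outA S E₀ cB) (outB S E₀ cB) W κ θ' C₅ := by
  obtain ⟨C₅, h⟩ := uniform_ne5_of_record (κ := κ) hE₀ hG hcA hcB hc₁ hr₀ hδ' hθ0 hθ1 hθθ' hθ'1 hω hω1 hh hsmall
  refine ⟨C₅, ?_⟩
  intro 𝔾 _ R E IOp Hist _ _ S W ROp RHist a hSω hT hbB hbA hdA hdB hRA hRB hwer hfl hins hbd hbud hline hOp hHist
  exact ne5_of_forall_singleton fun g hg =>
    h S hSω (hT g hg) (hbB g hg) (hbA g hg) (hdA g hg) (hdB g hg) (hRA g hg) (hRB g hg) (hwer g hg) hfl (hins g hg) (hbd g hg)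
      (hbud g hg) (hline g hg) hOp hHist

end Termwise

/-! ## §3 E1[rec] with W4 PRODUCED from the insertion-operator species, per singleton window -/

section InsOp

/-- [folklore] **THE η-UNIFORM TERMWISE FACE WITH W4 PRODUCED IS g-UNIFORM ACROSS SINGLETON WINDOWS** — §2 for
`B13StepEndArithmetic.uniform_ne5_of_record_insOp`: the insertion-operator species' one-run envelope `InsOpEnvelope {g} κ E₀ Gi` ∧ bound
`InsBoundA {g} κ E₀ Gi` and two-run rate `InsOpRate {g} δI θ` replace W4, per singleton, with an insertion margin `rI g` that may depend
on the coupling; ONE `C₅` from the sizes (`Gi, δI ≥ 0` among them) for every pair of runs, slot package (`S.D.ω = ω`), window and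
coupling. -/
theorem uniform_ne5_of_record_insOp_singleton {κ G EA₀ E₀ cA cB c₁ r₀ Gi δI θ θ' ω : ℝ}
    (hE₀ : 0 ≤ E₀) (hG : 0 ≤ G) (hcA : 0 ≤ cA) (hcB : 0 ≤ cB) (hc₁ : 0 ≤ c₁) (hr₀ : 0 < r₀) (hGi : 0 ≤ Gi)
    (hδI : 0 ≤ δI) (hθ0 : 0 < θ) (hθ1 : θ < 1) (hθθ' : θ ≤ θ') (hθ'1 : θ' ≤ 1) (hω : 0 < ω) (hω1 : ω < 1)
    (hh : cA * (EA₀ + E₀) < 1 - ω) (hsmall : ω + G * cA * (1 - ω) / (1 - ω - cA * (EA₀ + E₀)) < θ') :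
    ∃ C₅ : ℝ, ∀ {𝔾 : Type} [GaugeGroup 𝔾] {R : TwoRuns 𝔾} {E IOp Hist : Type*} [NormedAddCommGroup Hist] [NormedSpace ℂ Hist]
      [CompleteSpace Hist] [NormedAddCommGroup IOp] [NormedSpace ℂ IOp]
      (S : Slots R E IOp Hist) {W : Set (ℕ → ℝ)} {ROp RHist : ℕ → ℝ} {a : (ℕ → ℝ) → ℕ → TermIdx R.carriers.Dom (Bnd R) → ℝ}
      (rI : (ℕ → ℝ) → ℕ → ℝ) (hrI : ∀ g k, 0 < rI g k),
      S.D.ω = ω →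
      (∀ g ∈ W, (assembly S).TransportReads {g}) →
      (∀ g ∈ W, (assembly S).SliceBudgetB {g} κ cB) → (∀ g ∈ W, S.D.SliceBudget (step S E₀ cB) {g} κ cA) →
      (∀ g ∈ W, DecayBound (outA S E₀ cB) {g} EA₀ κ) → (∀ g ∈ W, DecayBound (outB S E₀ cB) {g} E₀ κ) →
      (∀ g ∈ W, RawBounded S.F (assembly S).rawAt {g}) → (∀ g ∈ W, RawBounded S.F S.rawB {g}) →
      (∀ g ∈ W, WeightedEntrywiseRate S.F (assembly S).rawAt S.rawB {g} c₁ (fun k => θ ^ k)) → (∀ k, r₀ ≤ S.rOp k) →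
      (∀ g ∈ W, (S.D.toInsOpModel (step S E₀ cB) (rI g) (hrI g)).InsOpEnvelope {g} κ E₀ Gi) →
      (∀ g ∈ W, (S.D.toInsOpModel (step S E₀ cB) (rI g) (hrI g)).InsBoundA {g} κ E₀ Gi) →
      (∀ g ∈ W, (S.D.toInsOpModel (step S E₀ cB) (rI g) (hrI g)).InsOpRate {g} δI θ) →
      (∀ g ∈ W, TermBound (ballClass (selfCtr (assembly S).raw (assembly S).histRef) ROp RHist)
        (term (assembly S).𝒯 (assembly S).inc S.act) {g} κ (a g)) →
      (∀ g ∈ W, TermBudget (a g) G) →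
      (∀ g ∈ W, TermLineAnalytic (ballClass (selfCtr (assembly S).raw (assembly S).histRef) ROp RHist)
        (term (assembly S).𝒯 (assembly S).inc S.act) {g}) →
      (∀ k, S.rOp k ≤ ROp k) → (∀ k, (assembly S).bHist E₀ cB k + S.rHist k ≤ RHist k) →
      NE5 (outA S E₀ cB) (outB S E₀ cB) W κ θ' C₅ := by
  obtain ⟨C₅, h⟩ :=
    uniform_ne5_of_record_insOp (κ := κ) hE₀ hG hcA hcB hc₁ hr₀ hGi hδI hθ0 hθ1 hθθ' hθ'1 hω hω1 hh hsmall
  refine ⟨C₅, ?_⟩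
  intro 𝔾 _ R E IOp Hist _ _ _ _ _ S W ROp RHist a rI hrI hSω hT hbB hbA hdA hdB hRA hRB hwer hfl hienv hibdA hirate hbd hbud hline
    hOp hHist
  exact ne5_of_forall_singleton fun g hg =>
    h S (rI g) (hrI g) hSω (hT g hg) (hbB g hg) (hbA g hg) (hdA g hg) (hdB g hg) (hRA g hg) (hRB g hg) (hwer g hg) hfl
      (hienv g hg) (hibdA g hg) (hirate g hg) (hbd g hg) (hbud g hg) (hline g hg) hOp hHist

end InsOp

/-! ## §4 E8 at the assembly of record (secant END, history half of W2 at activity level), per singleton window -/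

section Secant

/-- [folklore] **THE η-UNIFORM SECANT FACE OF RECORD IS g-UNIFORM ACROSS SINGLETON WINDOWS** — §2 for
`B13StepSecantArithmetic.uniform_ne5_of_record_secant`: sizes `κ, Λop, G₁, EA₀, E₀, cA, cB, c₁, r₀, δ′, θ, θ′, ω, ρ₀` with the one
strict size inequality `ω + 2·G₁·cA < θ′`; per singleton `{g}`: the reading, slice budgets, levels, W1's raw suppliers + entrywise rate +
floor, W4, the operator half DISPLAYED as `OpLipschitz (step S E₀ cB) {g} κ Λop ρ₀`, the history half's per-activity STRUCTURE
`ActExpLinearOn … (Dt g) … {g}` with g-indexed exponent bounds `N g`, absolute majorants `A g` (summable) and secant-majorant budget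
`G₁·e^{−κd}` per domain; the three radii conditions; ONE `C₅` for every pair of runs, slot package, window and coupling. -/
theorem uniform_ne5_of_record_secant_singleton {κ Λop G₁ EA₀ E₀ cA cB c₁ r₀ δ' θ θ' ω ρ₀ : ℝ}
    (hEA₀ : 0 ≤ EA₀) (hE₀ : 0 ≤ E₀) (hΛop : 0 ≤ Λop) (hG₁ : 0 ≤ G₁) (hcA : 0 ≤ cA) (hcB : 0 ≤ cB) (hc₁ : 0 ≤ c₁) (hr₀ : 0 < r₀)
    (hδ' : 0 ≤ δ') (hθ0 : 0 < θ) (hθ1 : θ < 1) (hθθ' : θ ≤ θ') (hθ'1 : θ' ≤ 1) (hω : 0 < ω) (hω1 : ω < 1) (hρ₀ : 0 < ρ₀)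
    (hsmall : ω + 2 * G₁ * cA < θ') :
    ∃ C₅ : ℝ, ∀ {𝔾 : Type} [GaugeGroup 𝔾] {R : TwoRuns 𝔾} {E IOp Hist Ω : Type*} [NormedAddCommGroup Hist] [NormedSpace ℂ Hist]
      [MeasurableSpace Ω] (S : Slots R E IOp Hist) {W : Set (ℕ → ℝ)} {ROp RHist : ℕ → ℝ}
      {N A : (ℕ → ℝ) → ℕ → (ℕ → ℝ) → R.carriers.BgB → R.carriers.Dom → InnerLabel R.carriers.Dom (Bnd R) → ℝ}
      {Dt : (ℕ → ℝ) → ActData R.carriers.Dom (InnerLabel R.carriers.Dom (Bnd R)) (OpDatum E) Hist Ω},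
      S.D.ω = ω →
      (∀ g ∈ W, (assembly S).TransportReads {g}) →
      (∀ g ∈ W, (assembly S).SliceBudgetB {g} κ cB) → (∀ g ∈ W, S.D.SliceBudget (step S E₀ cB) {g} κ cA) →
      (∀ g ∈ W, DecayBound (outA S E₀ cB) {g} EA₀ κ) → (∀ g ∈ W, DecayBound (outB S E₀ cB) {g} E₀ κ) →
      (∀ g ∈ W, RawBounded S.F (assembly S).rawAt {g}) → (∀ g ∈ W, RawBounded S.F S.rawB {g}) →
      (∀ g ∈ W, WeightedEntrywiseRate S.F (assembly S).rawAt S.rawB {g} c₁ (fun k => θ ^ k)) → (∀ k, r₀ ≤ S.rOp k) →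
      (∀ g ∈ W, (step S E₀ cB).InsertionRate {g} κ E₀ δ' θ) →
      (∀ g ∈ W, OpLipschitz (step S E₀ cB) {g} κ Λop ρ₀) →
      (∀ g ∈ W, ActExpLinearOn (assembly S).𝒯 S.act (Dt g)
        (ballClass (selfCtr (assembly S).raw (assembly S).histRef) ROp RHist) {g}) →
      (∀ g ∈ W, ActExpNormBound (assembly S).𝒯 (Dt g)
        (ballClass (selfCtr (assembly S).raw (assembly S).histRef) ROp RHist) {g} S.rHist (N g)) →
      (∀ g ∈ W, ∀ k g' U Z j, 0 ≤ N g k g' U Z j) →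
      (∀ g ∈ W, ActAbsBound (assembly S).𝒯 (Dt g)
        (ballClass (selfCtr (assembly S).raw (assembly S).histRef) ROp RHist) {g} (A g)) →
      (∀ g ∈ W, ∀ k, ∀ g' ∈ ({g} : Set (ℕ → ℝ)), ∀ (U : R.carriers.BgB) (X : R.carriers.Dom), R.carriers.scale X = k →
        Summable (actMajorant (assembly S).𝒯 (assembly S).inc (A g k g' U) k X)) →
      (∀ g ∈ W, ∀ k, ∀ g' ∈ ({g} : Set (ℕ → ℝ)), ∀ (U : R.carriers.BgB) (X : R.carriers.Dom), R.carriers.scale X = k →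
        Summable (secMajorant (assembly S).𝒯 (assembly S).inc (N g k g' U) (A g k g' U) k X) ∧
          ∑' i, secMajorant (assembly S).𝒯 (assembly S).inc (N g k g' U) (A g k g' U) k X i ≤
            G₁ * Real.exp (-(κ * R.carriers.d X))) →
      (∀ k, c₁ / r₀ * S.rOp k ≤ ROp k) → (∀ k, (assembly S).bHist E₀ cB k ≤ RHist k) →
      (∀ k, δ' * S.rHist k + EA₀ * (S.rHist k * (cA / (1 - S.D.ω))) ≤ RHist k) →
      NE5 (outA S E₀ cB) (outB S E₀ cB) W κ θ' C₅ := by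
  obtain ⟨C₅, h⟩ := uniform_ne5_of_record_secant (κ := κ) hEA₀ hE₀ hΛop hG₁ hcA hcB hc₁ hr₀ hδ' hθ0 hθ1 hθθ' hθ'1 hω hω1 hρ₀
    hsmall
  refine ⟨C₅, ?_⟩
  intro 𝔾 _ R E IOp Hist Ω _ _ _ S W ROp RHist N A Dt hSω hT hbB hbA hdA hdB hRA hRB hwer hfl hins hopL hexp hN hN0 habs hconv hmom
    hOp hHist hHistA
  exact ne5_of_forall_singleton fun g hg =>
    h S hSω (hT g hg) (hbB g hg) (hbA g hg) (hdA g hg) (hdB g hg) (hRA g hg) (hRB g hg) (hwer g hg) hfl (hins g hg) (hopL g hg)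
      (hexp g hg) (hN g hg) (hN0 g hg) (habs g hg) (hconv g hg) (hmom g hg) hOp hHist hHistA

end Secant

end Summit.QuantumFields.BalabanUV.T4Continuum.B13StepEndArithmeticWindow

end
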